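import Mathlib

/-!
# `θ = 1/2` is a bad value of the Marica–Schönheim pencil modulo EVERY prime `p ≥ 5`: the families `k · C(n, n−1) + top`

Helper file for crux `stmt-CriticalPhenomena-4575` (`NoHeavyLowerTail`, route `PercNearOneGluingNoHeavy`), new-inequality factory
seat `prim-ineq-gen-3` (gen 31).  Everything here is PROVED; no definitions.  Imports Mathlib only.  Memo:
`run/shared/lean/prim/prim-ineq-gen-3/FINDINGS-gen31.md` §F31-7, `PAPER-PRODUCTS.md` §4.  Generalizes `…OrderedDifferencesTwoTetra`
(`k = 2`, `n = 4`, `p = 5`, `θ = 3`).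

THE FAMILY.  On `Fin k × Fin n` (`k ≥ 2` copies of an `n`-set, `n ≥ 3`) take the `k·n` BLOCKS `B(c,j) = {(c,i) : i ≠ j}` (all `(n−1)`-subsets
of each copy) and the TOP set `univ`.  The differences are `∅`, the singletons (`B(c,j) \ B(c,j') = {(c,j')}`), the blocks
(`B(c,j) \ B(c',j')`, `c ≠ c'`) and the co-blocks (`univ \ B(c,j)`).  With weight `1` on every block and `−θ` on the top, the weighted
column sums of `[E ⊆ C] + θ [E ∩ C = ∅]` are `(kn − θ)(1 + θ)` (at `∅`), `(n−1) + θ (k−1) n` (singletons), `1 + θ ((k−1)n − 1)` (blocks)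
and `0` (co-blocks).  Hence the pencil rows are linearly dependent at `θ` over any field in which these three quantities vanish
(`copiesTop_not_linearIndependent_pencil`).  ARITHMETIC: for a prime `p ≥ 5` put `n = (p+3)/2` and choose `k ≡ 1 − n⁻¹ (mod p)`; then
`(k−1)n ≡ −1`, `θ = 1/2` solves all three congruences (`kn ≡ 1/2`).  So `θ = 1/2` — and by the product calculus of `…OrderedDifferencesProducts`
also `2`, `−2`, `−1/2` — is an eigenvalue of some family modulo every prime `p ≥ 5`, although no rational `t ≠ ±1` is bad in characteristic `0`
(`…OrderedDifferencesPencil`): the bad locus `B(𝔽̄_p)` contains `⟨−1, 2⟩` (all of `𝔽_p^×` when `±2` is a primitive root).  Instances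
`(k, n; p)`: `(2,4;5)`, `(5,5;7)`, `(4,7;11)` (`θ = 6` has multiplicative order `10` — eigenvalue orders in characteristic `p` are unbounded),
`(9,8;13)`, `(6,10;17)`, ….

* `mem_copiesBlock`, `copiesBlock_subset_copiesBlock_iff`, `disjoint_copiesBlock_copiesBlock_iff`, … — combinatorics of the blocks;
* `copiesTop_weighted_column_sum` — the four weighted column sums;
* `copiesTop_not_linearIndependent_pencil` — ★ the dependency.
(prim-ineq-gen-3 gen 31, 2026-08-26.)
-/

namespace Summit.CriticalPhenomena.PercolationContinuityZ3.Theorems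

namespace OrderedDifferences

open Finset
open scoped FinsetFamily

variable {k n : ℕ} {K : Type*} [Field K]

/-- Membership in a block `B(c,j) = {x : x.1 = c ∧ x.2 ≠ j}`. -/
theorem mem_copiesBlock (q : Fin k × Fin n) (x : Fin k × Fin n) :
    x ∈ (univ : Finset (Fin k × Fin n)).filter (fun x => x.1 = q.1 ∧ x.2 ≠ q.2) ↔ x.1 = q.1 ∧ x.2 ≠ q.2 := by
  simp

/-- In an `n`-set with `n ≥ 3` there is an index different from two given ones. -/
theorem exists_ne_ne_of_three_le (hn : 3 ≤ n) (j j' : Fin n) : ∃ i : Fin n, i ≠ j ∧ i ≠ j' := by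
  have hcard : 1 ≤ #(((univ : Finset (Fin n)).erase j).erase j') := by
    have h1 : #((univ : Finset (Fin n)).erase j) = n - 1 := by
      rw [card_erase_of_mem (mem_univ j), card_univ, Fintype.card_fin]
    have h2 : n - 2 ≤ #(((univ : Finset (Fin n)).erase j).erase j') := by
      have := pred_card_le_card_erase (s := (univ : Finset (Fin n)).erase j) (a := j')
      omega
    omega
  obtain ⟨i, hi⟩ := card_pos.mp (by omega : 0 < #(((univ : Finset (Fin n)).erase j).erase j'))
  rw [mem_erase, mem_erase] at hi
  exact ⟨i, hi.2.1, hi.1⟩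

/-- `B(q₀) ⊆ B(q)` iff `q = q₀` (for `n ≥ 3`). -/
theorem copiesBlock_subset_copiesBlock_iff (hn : 3 ≤ n) (q₀ q : Fin k × Fin n) :
    (univ : Finset (Fin k × Fin n)).filter (fun x => x.1 = q₀.1 ∧ x.2 ≠ q₀.2) ⊆
      (univ : Finset (Fin k × Fin n)).filter (fun x => x.1 = q.1 ∧ x.2 ≠ q.2) ↔ q = q₀ := by
  constructor
  · intro h
    obtain ⟨i, hi, hi'⟩ := exists_ne_ne_of_three_le hn q₀.2 q.2
    have hx : ((q₀.1, i) : Fin k × Fin n) ∈ (univ : Finset (Fin k × Fin n)).filter (fun x => x.1 = q₀.1 ∧ x.2 ≠ q₀.2) := by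
      rw [mem_copiesBlock]; exact ⟨rfl, hi⟩
    have hx' := h hx
    rw [mem_copiesBlock] at hx'
    -- so q.1 = q₀.1; now the element (q₀.1, q.2) decides q.2 = q₀.2
    have hc : q.1 = q₀.1 := hx'.1.symm
    by_contra hne
    have hj : q.2 ≠ q₀.2 := by
      intro hj; exact hne (Prod.ext hc hj)
    have hy : ((q₀.1, q.2) : Fin k × Fin n) ∈ (univ : Finset (Fin k × Fin n)).filter (fun x => x.1 = q₀.1 ∧ x.2 ≠ q₀.2) := by
      rw [mem_copiesBlock]; exact ⟨rfl, hj⟩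
    have hy' := h hy
    rw [mem_copiesBlock] at hy'
    exact hy'.2 rfl
  · rintro rfl
    exact Subset.rfl

/-- `B(q₀)` and `B(q)` are disjoint iff they lie in different copies (for `n ≥ 3`). -/
theorem disjoint_copiesBlock_copiesBlock_iff (hn : 3 ≤ n) (q₀ q : Fin k × Fin n) :
    Disjoint ((univ : Finset (Fin k × Fin n)).filter (fun x => x.1 = q₀.1 ∧ x.2 ≠ q₀.2))
      ((univ : Finset (Fin k × Fin n)).filter (fun x => x.1 = q.1 ∧ x.2 ≠ q.2)) ↔ q.1 ≠ q₀.1 := by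
  rw [disjoint_left]
  constructor
  · intro h hc
    obtain ⟨i, hi, hi'⟩ := exists_ne_ne_of_three_le hn q₀.2 q.2
    have hx : ((q₀.1, i) : Fin k × Fin n) ∈ (univ : Finset (Fin k × Fin n)).filter (fun x => x.1 = q₀.1 ∧ x.2 ≠ q₀.2) := by
      rw [mem_copiesBlock]; exact ⟨rfl, hi⟩
    exact h hx (by rw [mem_copiesBlock]; exact ⟨hc.symm, hi'⟩)
  · intro h x hx hx'
    rw [mem_copiesBlock] at hx hx'
    exact h (hx'.1.symm.trans hx.1)

/-- A singleton lies in `B(q)` iff its point does. -/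
theorem singleton_subset_copiesBlock_iff (x : Fin k × Fin n) (q : Fin k × Fin n) :
    ({x} : Finset (Fin k × Fin n)) ⊆ (univ : Finset (Fin k × Fin n)).filter (fun y => y.1 = q.1 ∧ y.2 ≠ q.2) ↔
      x.1 = q.1 ∧ x.2 ≠ q.2 := by
  rw [singleton_subset_iff, mem_copiesBlock]

/-- A singleton is disjoint from `B(q)` iff its point is not in it. -/
theorem disjoint_singleton_copiesBlock_iff (x : Fin k × Fin n) (q : Fin k × Fin n) :
    Disjoint ({x} : Finset (Fin k × Fin n)) ((univ : Finset (Fin k × Fin n)).filter (fun y => y.1 = q.1 ∧ y.2 ≠ q.2)) ↔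
      ¬ (x.1 = q.1 ∧ x.2 ≠ q.2) := by
  rw [disjoint_singleton_left, mem_copiesBlock]

/-- A co-block `univ \ B(q₀)` is contained in no block (for `k ≥ 2`). -/
theorem not_coBlock_subset_copiesBlock (hk : 2 ≤ k) (q₀ q : Fin k × Fin n) :
    ¬ (univ \ (univ : Finset (Fin k × Fin n)).filter (fun x => x.1 = q₀.1 ∧ x.2 ≠ q₀.2) ⊆
      (univ : Finset (Fin k × Fin n)).filter (fun x => x.1 = q.1 ∧ x.2 ≠ q.2)) := by
  intro h
  -- the point q₀ itself lies in the co-block, hence in B(q): so q.1 = q₀.1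
  have h0 : q₀ ∈ univ \ (univ : Finset (Fin k × Fin n)).filter (fun x => x.1 = q₀.1 ∧ x.2 ≠ q₀.2) := by
    rw [mem_sdiff, mem_copiesBlock]; exact ⟨mem_univ _, fun hh => hh.2 rfl⟩
  have h0' := h h0
  rw [mem_copiesBlock] at h0'
  -- a point of another copy lies in the co-block but not in B(q)
  obtain ⟨c, hc⟩ : ∃ c : Fin k, c ≠ q₀.1 := by
    have h1 : #((univ : Finset (Fin k)).erase q₀.1) = k - 1 := by
      rw [card_erase_of_mem (mem_univ _), card_univ, Fintype.card_fin]
    obtain ⟨c, hc⟩ := card_pos.mp (by omega : 0 < #((univ : Finset (Fin k)).erase q₀.1))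
    exact ⟨c, (mem_erase.mp hc).1⟩
  have h1 : ((c, q₀.2) : Fin k × Fin n) ∈ univ \ (univ : Finset (Fin k × Fin n)).filter (fun x => x.1 = q₀.1 ∧ x.2 ≠ q₀.2) := by
    rw [mem_sdiff, mem_copiesBlock]; exact ⟨mem_univ _, fun hh => hc hh.1⟩
  have h1' := h h1
  rw [mem_copiesBlock] at h1'
  exact hc (h1'.1.trans h0'.1.symm)

/-- A block is disjoint from the co-block `univ \ B(q₀)` iff it is `B(q₀)` (for `n ≥ 3`). -/
theorem disjoint_coBlock_copiesBlock_iff (hn : 3 ≤ n) (q₀ q : Fin k × Fin n) :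
    Disjoint (univ \ (univ : Finset (Fin k × Fin n)).filter (fun x => x.1 = q₀.1 ∧ x.2 ≠ q₀.2))
      ((univ : Finset (Fin k × Fin n)).filter (fun x => x.1 = q.1 ∧ x.2 ≠ q.2)) ↔ q = q₀ := by
  constructor
  · intro h
    have hsub : (univ : Finset (Fin k × Fin n)).filter (fun x => x.1 = q.1 ∧ x.2 ≠ q.2) ⊆
        (univ : Finset (Fin k × Fin n)).filter (fun x => x.1 = q₀.1 ∧ x.2 ≠ q₀.2) := by
      intro x hx
      by_contra hx'
      exact disjoint_left.mp h (mem_sdiff.mpr ⟨mem_univ x, hx'⟩) hx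
    exact ((copiesBlock_subset_copiesBlock_iff hn q q₀).mp hsub).symm
  · rintro rfl
    exact sdiff_disjoint

/-- Blocks in different copies are disjoint: `B(q₀) \ B(q) = B(q₀)` for `q.1 ≠ q₀.1`. -/
theorem copiesBlock_sdiff_copiesBlock_of_ne (q₀ q : Fin k × Fin n) (h : q.1 ≠ q₀.1) :
    (univ : Finset (Fin k × Fin n)).filter (fun x => x.1 = q₀.1 ∧ x.2 ≠ q₀.2) \
      (univ : Finset (Fin k × Fin n)).filter (fun x => x.1 = q.1 ∧ x.2 ≠ q.2) =
      (univ : Finset (Fin k × Fin n)).filter (fun x => x.1 = q₀.1 ∧ x.2 ≠ q₀.2) := by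
  refine sdiff_eq_self_of_disjoint (disjoint_left.mpr fun x hx hx' => ?_)
  rw [mem_copiesBlock] at hx hx'
  exact h (hx'.1.symm.trans hx.1)

/-- Within one copy the difference of two distinct blocks is a singleton: `B(c,j₀) \ B(c,j) = {(c,j)}`. -/
theorem copiesBlock_sdiff_copiesBlock_of_eq (q₀ q : Fin k × Fin n) (h : q.1 = q₀.1) (hj : q.2 ≠ q₀.2) :
    (univ : Finset (Fin k × Fin n)).filter (fun x => x.1 = q₀.1 ∧ x.2 ≠ q₀.2) \
      (univ : Finset (Fin k × Fin n)).filter (fun x => x.1 = q.1 ∧ x.2 ≠ q.2) = {(q₀.1, q.2)} := by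
  ext x
  rw [mem_sdiff, mem_copiesBlock, mem_copiesBlock, mem_singleton]
  constructor
  · rintro ⟨⟨h1, _⟩, h3⟩
    have : x.2 = q.2 := by
      by_contra hx
      exact h3 ⟨h1.trans h.symm, hx⟩
    exact Prod.ext h1 this
  · rintro rfl
    exact ⟨⟨rfl, hj⟩, fun hh => hh.2 rfl⟩

/-- There is a copy different from a given one (for `k ≥ 2`). -/
theorem exists_fst_ne_of_two_le (hk : 2 ≤ k) (c₀ : Fin k) : ∃ c : Fin k, c ≠ c₀ := by
  have h1 : #((univ : Finset (Fin k)).erase c₀) = k - 1 := by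
    rw [card_erase_of_mem (mem_univ c₀), card_univ, Fintype.card_fin]
  obtain ⟨c, hc⟩ := card_pos.mp (by omega : 0 < #((univ : Finset (Fin k)).erase c₀))
  exact ⟨c, (mem_erase.mp hc).1⟩

/-! ### The weighted column sums -/

/-- Sums of an indicator over the index set `Fin k × Fin n`: `∑_q [q = q₀] = 1`. -/
theorem sum_ite_eq_index (q₀ : Fin k × Fin n) (f : Fin k × Fin n → Prop) [DecidablePred f] (hf : ∀ q, f q ↔ q = q₀) :
    ∑ q : Fin k × Fin n, (if f q then (1 : K) else 0) = 1 := by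
  have : ∀ q : Fin k × Fin n, (if f q then (1 : K) else 0) = if q = q₀ then 1 else 0 := fun q => by
    simp only [hf q]
  simp_rw [this, Finset.sum_ite_eq', mem_univ, if_true]

/-- `∑_{q} [q.1 ≠ c₀] = (k − 1)·n` over `Fin k × Fin n`, in a field. -/
theorem sum_ite_fst_ne (c₀ : Fin k) :
    ∑ q : Fin k × Fin n, (if q.1 ≠ c₀ then (1 : K) else 0) = ((k : K) - 1) * n := by
  rw [Fintype.sum_prod_type]
  dsimp only
  have h : ∀ a : Fin k, ∑ _b : Fin n, (if a ≠ c₀ then (1 : K) else 0) = (n : K) * (if a ≠ c₀ then (1 : K) else 0) := by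
    intro a
    rw [sum_const, card_univ, Fintype.card_fin, nsmul_eq_mul]
  simp_rw [h, ← mul_sum]
  have e : ∀ a : Fin k, (if a ≠ c₀ then (1 : K) else 0) = 1 - (if a = c₀ then (1 : K) else 0) := by
    intro a; by_cases ha : a = c₀ <;> simp [ha]
  simp_rw [e, sum_sub_distrib, sum_const, card_univ, Fintype.card_fin, nsmul_eq_mul, mul_one, Finset.sum_ite_eq',
    mem_univ, if_true]
  ring

/-- `∑_{q} [q.1 = c₀ ∧ q.2 ≠ j₀] = n − 1` over `Fin k × Fin n`, in a field. -/
theorem sum_ite_fst_eq_snd_ne (c₀ : Fin k) (j₀ : Fin n) :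
    ∑ q : Fin k × Fin n, (if q.1 = c₀ ∧ q.2 ≠ j₀ then (1 : K) else 0) = (n : K) - 1 := by
  rw [Fintype.sum_prod_type]
  dsimp only
  have inner : ∀ a : Fin k, ∑ b : Fin n, (if a = c₀ ∧ b ≠ j₀ then (1 : K) else 0) =
      if a = c₀ then ((n : K) - 1) else 0 := by
    intro a
    by_cases ha : a = c₀
    · simp only [ha, true_and, if_true]
      have e : ∀ b : Fin n, (if b ≠ j₀ then (1 : K) else 0) = 1 - (if b = j₀ then (1 : K) else 0) := by
        intro b; by_cases hb : b = j₀ <;> simp [hb]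
      simp_rw [e, sum_sub_distrib, sum_const, card_univ, Fintype.card_fin, nsmul_eq_mul, mul_one, Finset.sum_ite_eq',
        mem_univ, if_true]
    · simp [ha]
  simp_rw [inner, Finset.sum_ite_eq', mem_univ, if_true]

/-- **The weighted column sums of the family `k·C(n,n−1) + top`.**  For members `C₁, C₂` and the weight `1` on blocks, `−θ` on the top:
`∑_C w_C ([C₁ \ C₂ ⊆ C] + θ [C₁ \ C₂ ∩ C = ∅]) = 0` provided `1 + θ((k−1)n − 1) = 0`, `(n−1) + θ(k−1)n = 0` and `(kn − θ)(1 + θ) = 0`. -/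
theorem copiesTop_weighted_column_sum (hk : 2 ≤ k) (hn : 3 ≤ n) (θ : K)
    (h1 : 1 + θ * (((k : K) - 1) * n - 1) = 0) (h2 : ((n : K) - 1) + θ * (((k : K) - 1) * n) = 0)
    (h3 : ((k : K) * n - θ) * (1 + θ) = 0)
    (C₁ C₂ : Finset (Fin k × Fin n))
    (hC₁ : C₁ ∈ insert (univ : Finset (Fin k × Fin n))
      ((univ : Finset (Fin k × Fin n)).image fun q => (univ : Finset (Fin k × Fin n)).filter (fun x => x.1 = q.1 ∧ x.2 ≠ q.2)))
    (hC₂ : C₂ ∈ insert (univ : Finset (Fin k × Fin n))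
      ((univ : Finset (Fin k × Fin n)).image fun q => (univ : Finset (Fin k × Fin n)).filter (fun x => x.1 = q.1 ∧ x.2 ≠ q.2))) :
    ∑ C ∈ insert (univ : Finset (Fin k × Fin n))
        ((univ : Finset (Fin k × Fin n)).image fun q => (univ : Finset (Fin k × Fin n)).filter (fun x => x.1 = q.1 ∧ x.2 ≠ q.2)),
      (if C = univ then -θ else (1 : K)) *
        ((if C₁ \ C₂ ⊆ C then (1 : K) else 0) + θ * (if Disjoint (C₁ \ C₂) C then (1 : K) else 0)) = 0 := by
  -- split the family sum into the top and the blocks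
  have huniv : (univ : Finset (Fin k × Fin n)) ∉
      (univ : Finset (Fin k × Fin n)).image (fun q => (univ : Finset (Fin k × Fin n)).filter (fun x => x.1 = q.1 ∧ x.2 ≠ q.2)) := by
    intro h
    obtain ⟨q, _, hq⟩ := mem_image.mp h
    have : q ∈ (univ : Finset (Fin k × Fin n)).filter (fun x => x.1 = q.1 ∧ x.2 ≠ q.2) := by rw [hq]; exact mem_univ q
    rw [mem_copiesBlock] at this
    exact this.2 rfl
  have hinj : Set.InjOn (fun q : Fin k × Fin n => (univ : Finset (Fin k × Fin n)).filter (fun x => x.1 = q.1 ∧ x.2 ≠ q.2))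
      (univ : Finset (Fin k × Fin n)) := by
    intro q _ q' _ h
    exact ((copiesBlock_subset_copiesBlock_iff hn q q').mp (le_of_eq h)).symm
  have hne : ∀ q : Fin k × Fin n, (univ : Finset (Fin k × Fin n)).filter (fun x => x.1 = q.1 ∧ x.2 ≠ q.2) ≠ univ := by
    intro q h
    exact huniv (mem_image.mpr ⟨q, mem_univ q, h⟩)
  rw [sum_insert huniv, sum_image hinj]
  simp only [if_true, hne, if_false, one_mul]
  -- generic shape: E := C₁ \ C₂;  top term + ∑_q ([E ⊆ B q] + θ [E ∩ B q = ∅])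
  set E := C₁ \ C₂ with hE
  have Euniv : E ⊆ univ := subset_univ E
  rw [if_pos Euniv]
  -- the four cases for E
  -- helper: value when E = ∅
  have case_empty : E = ∅ →
      -θ * (1 + θ * (if Disjoint E (univ : Finset (Fin k × Fin n)) then (1 : K) else 0)) +
        ∑ q : Fin k × Fin n, ((if E ⊆ (univ : Finset (Fin k × Fin n)).filter (fun x => x.1 = q.1 ∧ x.2 ≠ q.2) then (1 : K) else 0) +
          θ * (if Disjoint E ((univ : Finset (Fin k × Fin n)).filter (fun x => x.1 = q.1 ∧ x.2 ≠ q.2)) then (1 : K) else 0)) = 0 := by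
    intro h0
    rw [h0]
    simp only [empty_subset, if_true, disjoint_empty_left, sum_const, card_univ, Fintype.card_prod, Fintype.card_fin,
      nsmul_eq_mul, Nat.cast_mul]
    linear_combination h3
  rw [mem_insert, mem_image] at hC₁ hC₂
  rcases hC₁ with rfl | ⟨q₁, _, rfl⟩ <;> rcases hC₂ with rfl | ⟨q₂, _, rfl⟩
  · -- (top, top): E = ∅
    exact case_empty (Finset.sdiff_self _)
  · -- (top, block): co-block
    have hE' : E = univ \ (univ : Finset (Fin k × Fin n)).filter (fun x => x.1 = q₂.1 ∧ x.2 ≠ q₂.2) := rfl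
    have hdisj : ¬ Disjoint E (univ : Finset (Fin k × Fin n)) := by
      intro h
      have : q₂ ∈ univ \ (univ : Finset (Fin k × Fin n)).filter (fun x => x.1 = q₂.1 ∧ x.2 ≠ q₂.2) := by
        rw [mem_sdiff, mem_copiesBlock]; exact ⟨mem_univ _, fun hh => hh.2 rfl⟩
      rw [← hE'] at this
      exact disjoint_left.mp h this (mem_univ _)
    rw [if_neg hdisj]
    have s1 : ∀ q : Fin k × Fin n, (if E ⊆ (univ : Finset (Fin k × Fin n)).filter (fun x => x.1 = q.1 ∧ x.2 ≠ q.2) then (1 : K) else 0) = 0 :=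
      fun q => if_neg (by rw [hE']; exact not_coBlock_subset_copiesBlock hk q₂ q)
    have s2 : ∀ q : Fin k × Fin n, (if Disjoint E ((univ : Finset (Fin k × Fin n)).filter (fun x => x.1 = q.1 ∧ x.2 ≠ q.2)) then (1 : K) else 0) =
        if q = q₂ then 1 else 0 := fun q => by rw [hE']; simp only [disjoint_coBlock_copiesBlock_iff hn q₂ q]
    simp_rw [s1, s2, zero_add, ← mul_sum, Finset.sum_ite_eq', mem_univ, if_true]
    ring
  · -- (block, top): E = ∅
    exact case_empty (sdiff_eq_empty_iff_subset.mpr (subset_univ _))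
  · -- (block, block)
    by_cases hc : q₂.1 = q₁.1
    · by_cases hj : q₂.2 = q₁.2
      · -- same block
        have : q₂ = q₁ := Prod.ext hc hj
        subst this
        exact case_empty (Finset.sdiff_self _)
      · -- same copy, different index: singleton
        have hE' : E = {(q₁.1, q₂.2)} := copiesBlock_sdiff_copiesBlock_of_eq q₁ q₂ hc hj
        rw [hE']
        have hdisj : ¬ Disjoint ({(q₁.1, q₂.2)} : Finset (Fin k × Fin n)) univ :=
          fun h => disjoint_left.mp h (mem_singleton_self _) (mem_univ _)
        rw [if_neg hdisj]
        have s1 : ∀ q : Fin k × Fin n, (if ({(q₁.1, q₂.2)} : Finset (Fin k × Fin n)) ⊆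
            (univ : Finset (Fin k × Fin n)).filter (fun x => x.1 = q.1 ∧ x.2 ≠ q.2) then (1 : K) else 0) =
            if q.1 = q₁.1 ∧ q.2 ≠ q₂.2 then 1 else 0 := by
          intro q
          simp only [singleton_subset_copiesBlock_iff]
          by_cases h : q.1 = q₁.1 ∧ q.2 ≠ q₂.2
          · rw [if_pos h, if_pos ⟨h.1.symm, fun e => h.2 e.symm⟩]
          · rw [if_neg h, if_neg (fun h' => h ⟨h'.1.symm, fun e => h'.2 e.symm⟩)]
        have s2 : ∀ q : Fin k × Fin n, (if Disjoint ({(q₁.1, q₂.2)} : Finset (Fin k × Fin n))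
            ((univ : Finset (Fin k × Fin n)).filter (fun x => x.1 = q.1 ∧ x.2 ≠ q.2)) then (1 : K) else 0) =
            1 - (if q.1 = q₁.1 ∧ q.2 ≠ q₂.2 then 1 else 0) := by
          intro q
          simp only [disjoint_singleton_copiesBlock_iff]
          by_cases h : q.1 = q₁.1 ∧ q.2 ≠ q₂.2
          · rw [if_pos h, if_neg (fun h' => h' ⟨h.1.symm, fun e => h.2 e.symm⟩)]; ring
          · rw [if_neg h, if_pos (fun h' => h ⟨h'.1.symm, fun e => h'.2 e.symm⟩)]; ring
        simp_rw [s1, s2, sum_add_distrib, mul_sub, sum_sub_distrib, ← mul_sum, sum_ite_fst_eq_snd_ne, sum_const, card_univ,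
          Fintype.card_prod, Fintype.card_fin, nsmul_eq_mul, Nat.cast_mul, mul_one]
        linear_combination h2
    · -- different copies: E = block q₁
      have hE' : E = (univ : Finset (Fin k × Fin n)).filter (fun x => x.1 = q₁.1 ∧ x.2 ≠ q₁.2) :=
        copiesBlock_sdiff_copiesBlock_of_ne q₁ q₂ hc
      rw [hE']
      have hdisj : ¬ Disjoint ((univ : Finset (Fin k × Fin n)).filter (fun x => x.1 = q₁.1 ∧ x.2 ≠ q₁.2)) univ := by
        obtain ⟨i, hi, _⟩ := exists_ne_ne_of_three_le hn q₁.2 q₁.2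
        intro h
        exact disjoint_left.mp h (by rw [mem_copiesBlock]; exact ⟨rfl, hi⟩ : ((q₁.1, i) : Fin k × Fin n) ∈ _) (mem_univ _)
      rw [if_neg hdisj]
      have s1 : ∀ q : Fin k × Fin n, (if (univ : Finset (Fin k × Fin n)).filter (fun x => x.1 = q₁.1 ∧ x.2 ≠ q₁.2) ⊆
          (univ : Finset (Fin k × Fin n)).filter (fun x => x.1 = q.1 ∧ x.2 ≠ q.2) then (1 : K) else 0) = if q = q₁ then 1 else 0 :=
        fun q => by simp only [copiesBlock_subset_copiesBlock_iff hn q₁ q]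
      have s2 : ∀ q : Fin k × Fin n, (if Disjoint ((univ : Finset (Fin k × Fin n)).filter (fun x => x.1 = q₁.1 ∧ x.2 ≠ q₁.2))
          ((univ : Finset (Fin k × Fin n)).filter (fun x => x.1 = q.1 ∧ x.2 ≠ q.2)) then (1 : K) else 0) = if q.1 ≠ q₁.1 then 1 else 0 :=
        fun q => by simp only [disjoint_copiesBlock_copiesBlock_iff hn q₁ q]
      simp_rw [s1, s2, sum_add_distrib, ← mul_sum, Finset.sum_ite_eq', mem_univ, if_true, sum_ite_fst_ne]
      linear_combination h1

/-- **`θ` is a bad value of the pencil of `k·C(n,n−1) + top`** whenever `1 + θ((k−1)n − 1) = 0`, `(n−1) + θ(k−1)n = 0` and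
`(kn − θ)(1 + θ) = 0` in the field `K` (`k ≥ 2`, `n ≥ 3`): the pencil rows `C ↦ (E ↦ [E ⊆ C] + θ [E ∩ C = ∅])` over the difference set
are linearly dependent (weights `1` on the blocks, `−θ` on the top).  For every prime `p ≥ 5` the choices `n = (p+3)/2`, `k ≡ 1 − n⁻¹`,
`θ = 1/2` satisfy the hypotheses over `ZMod p`. -/
theorem copiesTop_not_linearIndependent_pencil (hk : 2 ≤ k) (hn : 3 ≤ n) (θ : K)
    (h1 : 1 + θ * (((k : K) - 1) * n - 1) = 0) (h2 : ((n : K) - 1) + θ * (((k : K) - 1) * n) = 0)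
    (h3 : ((k : K) * n - θ) * (1 + θ) = 0) :
    ¬ LinearIndependent K (fun A : (insert (univ : Finset (Fin k × Fin n))
        ((univ : Finset (Fin k × Fin n)).image fun q => (univ : Finset (Fin k × Fin n)).filter (fun x => x.1 = q.1 ∧ x.2 ≠ q.2)) :
          Finset (Finset (Fin k × Fin n))) =>
      fun E : ((insert (univ : Finset (Fin k × Fin n))
        ((univ : Finset (Fin k × Fin n)).image fun q => (univ : Finset (Fin k × Fin n)).filter (fun x => x.1 = q.1 ∧ x.2 ≠ q.2))) \\
        (insert (univ : Finset (Fin k × Fin n))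
        ((univ : Finset (Fin k × Fin n)).image fun q => (univ : Finset (Fin k × Fin n)).filter (fun x => x.1 = q.1 ∧ x.2 ≠ q.2)))
          : Finset (Finset (Fin k × Fin n))) =>
      (if (E : Finset (Fin k × Fin n)) ⊆ (A : Finset (Fin k × Fin n)) then (1 : K) else 0) +
        θ * (if Disjoint (E : Finset (Fin k × Fin n)) (A : Finset (Fin k × Fin n)) then (1 : K) else 0)) := by
  classical
  set 𝒜 := insert (univ : Finset (Fin k × Fin n))
    ((univ : Finset (Fin k × Fin n)).image fun q => (univ : Finset (Fin k × Fin n)).filter (fun x => x.1 = q.1 ∧ x.2 ≠ q.2)) with h𝒜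
  rw [Fintype.not_linearIndependent_iff]
  -- a block, to witness non-vanishing of the weights
  have hk0 : 0 < k := by omega
  have hn0 : 0 < n := by omega
  set q₀ : Fin k × Fin n := (⟨0, hk0⟩, ⟨0, hn0⟩) with hq₀
  have hB₀ : (univ : Finset (Fin k × Fin n)).filter (fun x => x.1 = q₀.1 ∧ x.2 ≠ q₀.2) ∈ 𝒜 :=
    mem_insert_of_mem (mem_image.mpr ⟨q₀, mem_univ _, rfl⟩)
  have hB₀ne : (univ : Finset (Fin k × Fin n)).filter (fun x => x.1 = q₀.1 ∧ x.2 ≠ q₀.2) ≠ univ := by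
    intro h
    have : q₀ ∈ (univ : Finset (Fin k × Fin n)).filter (fun x => x.1 = q₀.1 ∧ x.2 ≠ q₀.2) := by rw [h]; exact mem_univ _
    rw [mem_copiesBlock] at this
    exact this.2 rfl
  refine ⟨fun A => if (A : Finset (Fin k × Fin n)) = univ then -θ else 1, ?_, ⟨⟨_, hB₀⟩, by simp [hB₀ne]⟩⟩
  funext E
  obtain ⟨E, hE⟩ := E
  obtain ⟨C₁, hC₁, C₂, hC₂, rfl⟩ := mem_diffs.mp hE
  simp only [Finset.sum_apply, Pi.smul_apply, smul_eq_mul, Pi.zero_apply]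
  rw [sum_coe_sort 𝒜 (fun C => (if C = univ then -θ else (1 : K)) *
      ((if C₁ \ C₂ ⊆ C then (1 : K) else 0) + θ * (if Disjoint (C₁ \ C₂) C then (1 : K) else 0)))]
  exact copiesTop_weighted_column_sum hk hn θ h1 h2 h3 C₁ C₂ hC₁ hC₂

end OrderedDifferences

end Summit.CriticalPhenomena.PercolationContinuityZ3.Theorems
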